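import Literature.NumberTheory.Automorphic.PairLFunctionPolesRankNeLandau
import HarnessLib

/-!
# Arthur–Clozel (2.3) — the pole of `L^S(s, π ⊗ π̃)` at `s = 1` — from the Mœglin–Waldspurger
# continuation alone, by Landau's lemma (proofs only)

Topic `NumberTheory/Automorphic`; namespace `Literature.NumberTheory.Automorphic`. Proof file
(theorems only: no definition, no named fact, no instance) under the named fact
`JacquetShalika1981_partialPairL_pole_of_eq_conj` of `PairLFunctionPoles` — Arthur–Clozel,
*Simple algebras, base change, and the advanced theory of the trace formula*, Ann. of Math.
Stud. 120 (1989), Ch. 3 §2, (2.3), p. 200 of the printed volume (held scan chunk 171): for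
unitary cuspidal `π ≅ σ̃` on `GL_n(𝔸_K)`, "the limit `lim_{s → 1, Re s > 1} (s - 1) L^S(s, π ⊗ σ)`
exists and is finite and non-zero" ("cf. [Jacquet–Shalika II, Prop. 3.6]").

In print the statement has two halves: the *continuation* of `(s - 1) L^S(s, π ⊗ π̃)` through
`s = 1` (Jacquet–Shalika; Mœglin–Waldspurger (1989), Appendice, Corollaire (ii): `L(s, π × π̃)`
"a deux pôles simples en `0` et `1` et est holomorphe hors de ces points"; in the tree the named
fact `MoeglinWaldspurger1989_partialPairL_of_eq_conj` of `PairLFunctionMeromorphicContinuation`: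
`s (s - 1) L^S(s, π ⊗ π̃)` extends to an entire function `G`) and the *presence* of the pole,
i.e. the non-vanishing of the residue `G(1) ≠ 0`, which in print is read off the residue of the
Rankin–Selberg integral (Jacquet–Shalika I, §4; the road taken by `PairLFunctionPolesRankinSelberg`,
`PairLFunctionPolesRealMoments`, `RankinSelbergResidueDatum`). This file proves the fact **from the
continuation alone**, replacing the residue computation by the positivity argument of
Jacquet–Shalika's own proof of Thm. (5.3) of *Euler products I* (p. 556, (1)–(5): "by Landau's
lemma the series … would converge for `Re s > 0` … a contradiction"), exactly as the companion file
`PairLFunctionPolesRankNeLandau` does for (2.2) at `s = 1`: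

* if `G(1) = 0`, the function `D(s) = G(s) / (s (s - 1))` (`= dslope G 1 (s) / s`) is holomorphic
  on `Re s > 0` and equals `L^S(s, π ⊗ π̄) = exp (∑_{v ∉ S} ∑_k |tr A_v^k|² q_v^{-ks} / k)` — a
  Dirichlet series with **non-negative** coefficients (Jacquet–Shalika (1981), (5.3.3); in the tree
  `partialPairL_conjFamily_eq_exp_LSeries`, `normSqTraceSeries_nonneg`, with the local bound
  (5.1.3) the theorem `norm_satakeParameter_le_sqrt_holds`) — on `Re s > 2`;
* by **Landau's lemma** (Montgomery–Vaughan Thm. 1.7, in the tree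
  `Literature.NumberTheory.LFunctions.Landau.abscissaOfAbsConv_le_of_exp_eq`) the series then
  converges absolutely for every `σ > 0`, in particular at `σ = 1/n`;
* but `|∏ A_v| = |ω_π(ϖ_v)| = 1` (unitary central character,
  `CuspidalAutomorphicRepGL.exists_centralCharacter`), so by Newton's identities some power sum
  `p_k(A_v)`, `k ≤ n`, has `|p_k(A_v)| ≥ 2^{-(n+1)}` and the series at `σ = 1/n` dominates
  `c ∑_v q_v^{-1} = ∞` (`not_summable_jsCoeff_mul_rpow_neg_of_norm_prod_eq_one` of
  `PairLFunctionPolesRankNeLandau`) — a contradiction.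

Hence `G(1) ≠ 0` and `(s - 1) L^S(s, π ⊗ σ) = G(s) / s → G(1)` as `s → 1`, `Re s > 1`.

Main results:

* `partialPairL_conjFamily_continuation_apply_one_ne_zero` — the analytic core: an entire `G` with
  `G(s) = s (s - 1) L^S(s, α ⊗ ᾱ)` on `Re s > 1`, `α` a Satake family of a cuspidal `π` on `GL_n`
  (`n ≥ 1`) off a finite `S`, has `G(1) ≠ 0`;
* `JacquetShalika1981_partialPairL_pole_of_eq_conj_of_moeglinWaldspurger` — **the named fact (2.3)
  from `MoeglinWaldspurger1989_partialPairL_of_eq_conj` and nothing else.**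

Together with `JacquetShalika1981_partialPairL_at_one_of_ne_conj_of_moeglinWaldspurger`
(`PairLFunctionPolesRankNeLandau`) this makes both analytic inputs (2.2), (2.3) of Arthur–Clozel's
Ch. 3, Thm. 3.1 (`ArthurClozelFibresProofs`) consequences of the Mœglin–Waldspurger continuation
facts (i)(b), (ii).

## References

* J. Arthur, L. Clozel, *Simple algebras, base change, and the advanced theory of the trace
  formula*, Ann. of Math. Stud. 120 (1989), Ch. 3 §2, (2.3), p. 200. [ArthurClozelAMS120]
* C. Mœglin, J.-L. Waldspurger, *Le spectre résiduel de `GL(n)`*, Ann. Sci. ÉNS (4) 22 (1989),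
  Appendice, Corollaire (ii), p. 667. [MoeglinWaldspurger1989]
* H. Jacquet, J. A. Shalika, *On Euler products and the classification of automorphic
  representations I*, Amer. J. Math. 103 (1981), Thm. (5.3) and its proof, p. 556.
  [JacquetShalikaAJM1981]
* H. L. Montgomery, R. C. Vaughan, *Multiplicative Number Theory I*, CUP (2007), §1.2, Thm. 1.7
  (Landau). [MontgomeryVaughan2007]
-/

noncomputable section

open scoped Topology ComplexConjugate
open NumberField IsDedekindDomain MeasureTheory Filter Complex

namespace Literature.NumberTheory.Automorphic

open AdelicGroupData

section Global

variable {n : ℕ} {K : Type} [Field K] [NumberField K]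
  {μ : Measure (gl n K).automorphicQuotient} [(gl n K).IsAutomorphicMeasure μ]

/-! ### The analytic core: the residue of `L^S(s, π ⊗ π̄)` at `s = 1` is not zero -/

/-- **The analytic core (Jacquet–Shalika's positivity argument with Landau's lemma).** Let `α` be
a Satake family of a cuspidal `π` on `GL_n(𝔸_K)` (`n ≥ 1`) off a finite `S`, and let `G` be an
entire function with `G(s) = s (s - 1) L^S(s, π ⊗ π̄) = s (s - 1) · partialPairL S α ᾱ s` on
`Re s > 1`. Then **`G(1) ≠ 0`**: otherwise `D = dslope G 1 / s` is holomorphic on `Re s > 0` and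
equals `exp (∑ a_m m^{-s})`, `a_m ≥ 0` (the series (5.3.3)), on `Re s > 2`, so by Landau's lemma
that series converges at `σ = 1/n`, contradicting
`not_summable_jsCoeff_mul_rpow_neg_of_norm_prod_eq_one` (`|∏ A_v| = |ω_π(ϖ_v)| = 1`).
[cite: JacquetShalikaAJM1981, Thm. (5.3), proof, p. 556]
[cite: MontgomeryVaughan2007, §1.2 Thm. 1.7] -/
theorem partialPairL_conjFamily_continuation_apply_one_ne_zero (hn : 0 < n)
    (P : CuspidalAutomorphicRepGL n K μ) {S : Set (HeightOneSpectrum (𝓞 K))} (hS : S.Finite)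
    {α : SatakeFamily K} (hα : IsSatakeFamilyOf P S α)
    {G : ℂ → ℂ} (hG : Differentiable ℂ G)
    (hGeq : ∀ s : ℂ, 1 < s.re → G s = s * (s - 1) * partialPairL S α (conjFamily α) s) :
    G 1 ≠ 0 := by
  intro hG1
  have hn1 : 1 ≤ n := hn
  -- local data of `α`: the bound (5.1.3), the size `n`, and `|∏ A_v| = 1`
  have hb : ∀ v ∉ S, ∀ a ∈ α v, ‖a‖ ≤ Real.sqrt v.residueCard := fun v hv a ha =>
    norm_satakeParameter_le_sqrt_holds P hα hv ha
  have hcard : ∀ v ∉ S, Multiset.card (α v) = n := fun v hv => hα.card_eq hv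
  have hcard' : ∀ v ∉ S, Multiset.card (α v) ≤ n := fun v hv => (hcard v hv).le
  have hprod : ∀ v ∉ S, ‖(α v).prod‖ = 1 := by
    intro v hv
    obtain ⟨ω, hu, -, -, -, hfam⟩ := P.exists_centralCharacter
    rw [← (hfam hα v hv).2]
    exact Literature.NumberTheory.GaloisRepresentations.HeckeCharacter.norm_valueAtUniformizer_of_isUnitary hu v
  -- the auxiliary function `D = G / (s (s - 1))`, holomorphic on `Re s > 0` because `G 1 = 0`
  set U : Set ℂ := {s : ℂ | (0 : ℝ) < s.re} with hU
  have hUo : IsOpen U := isOpen_lt continuous_const Complex.continuous_re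
  have h1U : U ∈ 𝓝 (1 : ℂ) := hUo.mem_nhds (by simp [hU])
  set D : ℂ → ℂ := fun s => dslope G 1 s / s with hD
  have hDd : DifferentiableOn ℂ D U := by
    have hdG : DifferentiableOn ℂ (dslope G 1) U :=
      (differentiableOn_dslope h1U).mpr hG.differentiableOn
    refine hdG.div differentiableOn_id fun s hs h => ?_
    simp only [hU, Set.mem_setOf_eq] at hs h
    rw [h, Complex.zero_re] at hs
    exact lt_irrefl _ hs
  have hDeq : ∀ s : ℂ, 1 < s.re → D s = partialPairL S α (conjFamily α) s := by
    intro s hs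
    have hs0 : s ≠ 0 := by
      rintro rfl
      rw [Complex.zero_re] at hs
      linarith
    have hs1 : s - 1 ≠ 0 := by
      intro h
      rw [sub_eq_zero] at h
      rw [h, Complex.one_re] at hs
      exact lt_irrefl _ hs
    have hdG : dslope G 1 s = G s / (s - 1) := by
      have h := sub_smul_dslope G 1 s
      rw [hG1, sub_zero, smul_eq_mul] at h
      rw [eq_div_iff hs1, mul_comm]
      exact h
    simp only [hD]
    rw [hdG, hGeq s hs]
    field_simp
  -- Landau's lemma: the abscissa of `∑ a_m m^{-s}` is `≤ 0`
  have hax2 := abscissaOfAbsConv_normSqTraceSeries_le_two hb hcard'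
  have hax0 : LSeries.abscissaOfAbsConv (normSqTraceSeries S α) ≤ (0 : ℝ) :=
    Literature.NumberTheory.LFunctions.Landau.abscissaOfAbsConv_le_of_exp_eq
      (normSqTraceSeries_nonneg S α) hax2 hDd fun s hs => by
        rw [hDeq s (by linarith), partialPairL_conjFamily_eq_exp_LSeries hb hcard' hs]
  -- hence the series (5.3.3) of `α` converges at `σ = 1/n` …
  have hN0 : (0 : ℝ) < 1 / n := by
    have : (0 : ℝ) < n := by exact_mod_cast hn
    positivity
  have hσ : LSeriesSummable (normSqTraceSeries S α) ((1 / n : ℝ) : ℂ) := by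
    refine LSeriesSummable_of_abscissaOfAbsConv_lt_re (hax0.trans_lt ?_)
    rw [Complex.ofReal_re]
    exact_mod_cast hN0
  have hsum := (summable_jsCoeff_mul_rpow_neg_iff S α (1 / n : ℝ)).mpr hσ
  -- … which it does not
  exact not_summable_jsCoeff_mul_rpow_neg_of_norm_prod_eq_one hS hn1 hcard hprod hsum

/-! ### Arthur–Clozel (2.3) from the Mœglin–Waldspurger continuation -/

/-- **Jacquet–Shalika / Arthur–Clozel (2.3) from Mœglin–Waldspurger, Corollaire (ii).** The named
fact `JacquetShalika1981_partialPairL_pole_of_eq_conj` — for unitary cuspidal `π ≅ σ̃` on `GL_n(𝔸_K)`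
(`n ≥ 1`, rendered `P = P'.conj`) with Satake families `α`, `β` off a finite `S`,
`(s - 1) L^S(s, π ⊗ σ) → c ≠ 0` as `s → 1`, `Re s > 1` — follows from the continuation fact
`MoeglinWaldspurger1989_partialPairL_of_eq_conj` (`s (s - 1) L^S(s, π ⊗ σ)` extends to an entire
`G`) **alone**: the limit is `G(1)` (`(s - 1) L^S(s) = G(s) / s` on `Re s > 1`), and `G(1) ≠ 0` by
`partialPairL_conjFamily_continuation_apply_one_ne_zero` — Jacquet–Shalika's positivity argument
with Landau's lemma in place of the residue of the Rankin–Selberg integral — after identifying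
`β` with `ᾱ` off `S` (both are Satake families of `σ = π̄`; uniqueness of Satake parameters,
`partialPairL_eq_of_isSatakeFamilyOf`). [cite: ArthurClozelAMS120, Ch. 3 §2 (2.3)]
[cite: MoeglinWaldspurger1989, Appendice, Corollaire (ii), p. 667]
[cite: JacquetShalikaAJM1981, Thm. (5.3), proof, p. 556] -/
theorem JacquetShalika1981_partialPairL_pole_of_eq_conj_of_moeglinWaldspurger
    (h₂ : MoeglinWaldspurger1989_partialPairL_of_eq_conj (n := n) (K := K) (μ := μ)) :
    JacquetShalika1981_partialPairL_pole_of_eq_conj (n := n) (K := K) (μ := μ) := by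
  intro hn P P' he S hS α β hα hβ
  obtain ⟨G, hG, hGeq⟩ := h₂ hn P P' he hS hα hβ
  -- `β` agrees with `ᾱ` off `S`: both are Satake families of `σ = π̄` (`P' = P.conj`)
  have hβ' : IsSatakeFamilyOf P' S (conjFamily α) := by
    have h := hα.conj
    rw [he, CuspidalAutomorphicRepGL.conj_conj] at h
    exact h
  have hLeq : partialPairL S α β = partialPairL S α (conjFamily α) :=
    partialPairL_eq_of_isSatakeFamilyOf subset_rfl subset_rfl hα hβ hα hβ'
  have hGeq' : ∀ s : ℂ, 1 < s.re → G s = s * (s - 1) * partialPairL S α (conjFamily α) s :=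
    fun s hs => by rw [hGeq s hs, hLeq]
  have hG1 : G 1 ≠ 0 :=
    partialPairL_conjFamily_continuation_apply_one_ne_zero hn P hS hα hG hGeq'
  refine ⟨G 1, hG1, ?_⟩
  -- `(s - 1) L^S(s) = G s / s → G 1 / 1`
  have hGc : Tendsto G (𝓝[{s : ℂ | 1 < s.re}] 1) (𝓝 (G 1)) :=
    (hG 1).continuousAt.tendsto.mono_left nhdsWithin_le_nhds
  have hid : Tendsto (fun s : ℂ => s) (𝓝[{s : ℂ | 1 < s.re}] 1) (𝓝 1) :=
    (continuous_id.tendsto 1).mono_left nhdsWithin_le_nhds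
  have hdiv : Tendsto (fun s : ℂ => G s / s) (𝓝[{s : ℂ | 1 < s.re}] 1) (𝓝 (G 1 / 1)) :=
    hGc.div hid one_ne_zero
  rw [div_one] at hdiv
  refine hdiv.congr' ?_
  filter_upwards [self_mem_nhdsWithin] with s hs
  have hs1 : 1 < s.re := hs
  have hs0 : s ≠ 0 := by
    rintro rfl
    rw [Complex.zero_re] at hs1
    linarith
  rw [hGeq s hs1, mul_assoc, mul_div_cancel_left₀ _ hs0]

end Global

end Literature.NumberTheory.Automorphic

end
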